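import Summits.KontsevichZagierPeriods.KontsevichZagierPeriods.Theses.HurwitzMicroSectors
import Literature.NumberTheory.Transcendental.KZVolumeConjectureProofs
import Literature.NumberTheory.Transcendental.KZKernelConjectureForms

/-!
# Crux-triage r1-1 checks for crux `NormalFormPrinciple` (stmt-KontsevichZagierPeriods-3869)

Kernel-checked COSTUME MEASURE used by the triage of the seven round-1 ideas:
the crux is the summit, and the summit is the printed volume conjecture, by tree theorems only.
Hence every "transfer" whose target is `KZ.volumeConjectureCompact` / `VolumeForm` (3814) is a
transfer to the crux itself (cards `volume-frame-merge`, `compact-volume-normal-forms`).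
-/

set_option linter.dupNamespace false

namespace Summit.KontsevichZagierPeriods.KontsevichZagierPeriods.Cruxes.NormalFormPrinciple.Triage1

open Literature.NumberTheory.Transcendental
open Summit.KontsevichZagierPeriods.KontsevichZagierPeriods.Theses.HurwitzMicroSectors

/-- The crux IS the summit: `→` is the route's certified `closes`; `←` takes `𝒩 := rational reps`. -/
theorem normalFormPrinciple_iff_statement : NormalFormPrinciple ↔ KontsevichZagierPeriods := by
  constructor
  · exact closes
  · intro h
    refine ⟨fun n => {r | r.IsRational}, ?_, ?_⟩
    · intro n m N N' hN hN' hv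
      exact (KontsevichZagierPeriods_iff.mp h) N N' hN hN' hv
    · intro n r hr
      exact ⟨n, r, hr, KZ.Equivalent.refl r⟩

/-- The crux IS the printed Cresson–Viu-Sos volume conjecture (tree: Viu-Sos semi-canonical
reduction, proved). -/
theorem normalFormPrinciple_iff_volumeConjectureCompact :
    NormalFormPrinciple ↔ KZ.volumeConjectureCompact := by
  rw [normalFormPrinciple_iff_statement, KontsevichZagierPeriods_iff,
    ← kzPeriodConjecture'_iff_isRational]
  exact KZ.kzPeriodConjecture'_iff_volumeConjectureCompact_holds

/-- The "greedy" family makes RIGIDITY trivial and REDUCTION the summit; the "full" family makes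
REDUCTION trivial and RIGIDITY the summit (recorded: the ∃𝒩 has content only for an independently
cut-out 𝒩). Here: with `𝒩 := ∅` rigidity holds vacuously. -/
theorem rigidity_of_empty :
    ∀ (n m : ℕ) (N : KZ.IntegralRep n) (N' : KZ.IntegralRep m),
      N ∈ (fun _ : ℕ => (∅ : Set (KZ.IntegralRep n))) n → N' ∈ (∅ : Set (KZ.IntegralRep m)) →
      N.value = N'.value → KZ.Equivalent N N' := by
  intro n m N N' hN _ _
  exact absurd hN (Set.notMem_empty N)

end Summit.KontsevichZagierPeriods.KontsevichZagierPeriods.Cruxes.NormalFormPrinciple.Triage1
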